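import Mathlib
import Summits.NavierStokesRegularity.NavierStokesRegularity.Theorems.EulerZoomLiouvillePowerGaugeEulerLiouvilleDSSNodeSpectralGrowth
import Summits.NavierStokesRegularity.NavierStokesRegularity.Theorems.EulerZoomLiouvillePowerGaugeEulerLiouvilleDSSNodeSpectralGrowthReal
import HarnessLib.Audit

/-!
# Crux E `PowerGaugeEulerLiouville` (stmt-NavierStokesRegularity-19832): THE SPECTRAL TRICHOTOMY OF AN OPERATOR ON `ℝ³` WITH `0 < det M < R`, `R > 1` —
# a dominated contracting splitting of a power of `M`, or of `M²`, or a power with `‖M^{k₀}‖ < R^{k₀}` (Gelfand-free; width seat ns-cas-k2 g3, tool E part 3)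

Route `EulerZoomLiouville` (NavierStokesRegularity), crux E.  At a permanent node of an `l`-DSS member the period map has `det DF(x*) = l³ < lT =: R`; the vorticity
there (if any) is an eigenvector with eigenvalue EXACTLY `R`.  This file classifies every operator `M` on `ℝ³` with `0 < det M < R`, `1 < R`:
* `exists_pos_eigenvalue_of_det_pos` — `det M > 0` ⇒ a POSITIVE real eigenvalue (the monic cubic `χ_M` has `χ_M(0) = −det M < 0`; intermediate values);
* `exists_normPow_lt_of_bound` — a growth bound `‖M^k‖ ≤ C (k+1)² s^k` with `0 ≤ s < R` gives `k₀ ≥ 1` with `‖M^{k₀}‖ < R^{k₀}`;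
* **`spectral_trichotomy`** — (T1) `M` has a dominated contracting splitting of a power (shape of `addHaar_pastHistorySet_eq_zero_of_dominated_pow`), OR (T2) `M·M` has one,
  OR (T3) `∃ k₀ ≥ 1, ‖M^{k₀}‖ < R^{k₀}`.  Cases on the positive eigenvalue `μ` and its cofactor: `μ ≥ R` (A′); complex pair of modulus `≥ R` (then `μ < 1`: A″
  `exists_splitting_of_expandingPair`); real root `≥ R` (A′) or `≤ −R` (A′ for `M²`); all moduli `< R` (growth bounds `…complexPair_global` / `…realRoots_global` ⇒ T3).

WHAT THIS IS NOT: not NS regularity, not the crux E — finite-dimensional linear algebra for hypothetical DSS blow-up members; 19832 is OPEN. [folklore]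
-/

noncomputable section

set_option linter.dupNamespace false

open Set Filter Topology Function
open scoped RealInnerProductSpace

namespace Summit.NavierStokesRegularity.NavierStokesRegularity.Theorems.PowerGaugeEulerLiouville.DSSNodes

/-! ### A positive real eigenvalue -/

/-- **`det M > 0` ⇒ a positive real eigenvalue** (on `ℝ³`). [folklore] -/
theorem exists_pos_eigenvalue_of_det_pos (M : EuclideanSpace ℝ (Fin 3) →L[ℝ] EuclideanSpace ℝ (Fin 3)) (hdet : 0 < M.det) :
    ∃ μ : ℝ, 0 < μ ∧ ∃ v : EuclideanSpace ℝ (Fin 3), v ≠ 0 ∧ M v = μ • v := by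
  set f : EuclideanSpace ℝ (Fin 3) →ₗ[ℝ] EuclideanSpace ℝ (Fin 3) :=
    (M : EuclideanSpace ℝ (Fin 3) →ₗ[ℝ] EuclideanSpace ℝ (Fin 3)) with hf
  set p : Polynomial ℝ := f.charpoly with hp
  have hp3 : p.natDegree = 3 := by rw [hp, LinearMap.charpoly_natDegree, finrank_euclideanSpace_fin]
  have hmonic : p.Monic := LinearMap.charpoly_monic f
  have hp0 : p.eval 0 < 0 := by
    rw [← Polynomial.coeff_zero_eq_eval_zero]
    have h := det_eq_neg_charpoly_coeff_zero f
    have hdet' : M.det = LinearMap.det f := rfl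
    linarith
  have hdeg : 0 < p.degree := by
    rw [Polynomial.degree_eq_natDegree hmonic.ne_zero, hp3]; exact_mod_cast (by norm_num : (0:ℕ) < 3)
  have htop := Polynomial.tendsto_atTop_of_leadingCoeff_nonneg p hdeg (by rw [hmonic.leadingCoeff]; exact zero_le_one)
  obtain ⟨R, hR1, hRp⟩ : ∃ R : ℝ, 0 ≤ R ∧ 0 < p.eval R := by
    obtain ⟨N, hN⟩ := eventually_atTop.1 (htop.eventually (eventually_gt_atTop 0))
    exact ⟨max N 0, le_max_right _ _, hN _ (le_max_left _ _)⟩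
  -- intermediate value on `[0, R]`
  have hcont : ContinuousOn (fun x => p.eval x) (Icc 0 R) := p.continuous.continuousOn
  obtain ⟨μ, hμI, hμ⟩ := intermediate_value_Icc hR1 hcont ⟨hp0.le, hRp.le⟩
  have hμ0 : μ ≠ 0 := by
    rintro rfl; simp only at hμ; linarith
  have hμpos : 0 < μ := lt_of_le_of_ne hμI.1 (Ne.symm hμ0)
  have hroot : p.IsRoot μ := hμ
  have hev : Module.End.HasEigenvalue f μ := (Module.End.hasEigenvalue_iff_isRoot_charpoly f μ).2 hroot
  obtain ⟨v, hv⟩ := hev.exists_hasEigenvector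
  exact ⟨μ, hμpos, v, hv.2, Module.End.mem_eigenspace_iff.1 hv.1⟩

/-! ### From a growth bound to a contracting power -/

/-- A growth bound `‖M^k x‖ ≤ C (k+1)² s^k ‖x‖` with `0 ≤ s < R` gives some `k₀ ≥ 1` with `‖M^{k₀}‖ < R^{k₀}`. [folklore] -/
theorem exists_normPow_lt_of_bound (M : EuclideanSpace ℝ (Fin 3) →L[ℝ] EuclideanSpace ℝ (Fin 3)) {C s R : ℝ} (hC : 0 ≤ C)
    (hs : 0 ≤ s) (hsR : s < R)
    (hbound : ∀ (k : ℕ) (x : EuclideanSpace ℝ (Fin 3)), ‖(M ^ k) x‖ ≤ C * ((k : ℝ) + 1) ^ 2 * s ^ k * ‖x‖) :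
    ∃ k₀ : ℕ, 0 < k₀ ∧ ‖M ^ k₀‖ < R ^ k₀ := by
  have hR0 : 0 < R := lt_of_le_of_lt hs hsR
  set θ : ℝ := s / R with hθ
  have hθ0 : 0 ≤ θ := div_nonneg hs hR0.le
  have hθ1 : θ < 1 := (div_lt_one hR0).2 hsR
  -- `C (k+1)² θ^k → 0`
  have hlim : Tendsto (fun k : ℕ => C * ((k : ℝ) + 1) ^ 2 * θ ^ k) atTop (𝓝 0) := by
    have hθ' : |θ| < 1 := by rwa [abs_of_nonneg hθ0]
    have h2 : Tendsto (fun k : ℕ => (k : ℝ) ^ 2 * θ ^ k) atTop (𝓝 0) := tendsto_pow_const_mul_const_pow_of_abs_lt_one 2 hθ'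
    have h1 : Tendsto (fun k : ℕ => (k : ℝ) ^ 1 * θ ^ k) atTop (𝓝 0) := tendsto_pow_const_mul_const_pow_of_abs_lt_one 1 hθ'
    have h0 : Tendsto (fun k : ℕ => θ ^ k) atTop (𝓝 0) := tendsto_pow_atTop_nhds_zero_of_lt_one hθ0 hθ1
    have h := ((h2.add (h1.const_mul 2)).add h0).const_mul C
    simp only [mul_zero, add_zero] at h
    refine h.congr fun k => ?_
    ring
  obtain ⟨k₀, hk₀1, hk₀⟩ := exists_ge_one_lt_one_of_tendsto hlim
  refine ⟨k₀, hk₀1, ?_⟩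
  have hRk : 0 < R ^ k₀ := pow_pos hR0 _
  have hop : ‖M ^ k₀‖ ≤ C * ((k₀ : ℝ) + 1) ^ 2 * s ^ k₀ :=
    ContinuousLinearMap.opNorm_le_bound _ (by positivity) fun x => hbound k₀ x
  have e : C * ((k₀ : ℝ) + 1) ^ 2 * s ^ k₀ = (C * ((k₀ : ℝ) + 1) ^ 2 * θ ^ k₀) * R ^ k₀ := by
    rw [hθ, div_pow]; field_simp
  rw [e] at hop
  calc ‖M ^ k₀‖ ≤ (C * ((k₀ : ℝ) + 1) ^ 2 * θ ^ k₀) * R ^ k₀ := hop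
    _ < 1 * R ^ k₀ := mul_lt_mul_of_pos_right hk₀ hRk
    _ = R ^ k₀ := one_mul _

/-! ### The trichotomy -/

/-- **SPECTRAL TRICHOTOMY.**  `M` an operator on `ℝ³` with `0 < det M < R` and `1 < R`.  Then one of:
(T1) `M` admits complementary invariant subspaces `Es`, `Ec ≠ ⊤` and `k ≥ 1`, `a < 1`, `a < b` with `‖M^k x‖ ≤ a‖x‖` on `Es`, `b‖x‖ ≤ ‖M^k x‖` on `Ec`;
(T2) the same for `M·M`;
(T3) `‖M^{k₀}‖ < R^{k₀}` for some `k₀ ≥ 1`. [folklore] -/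
theorem spectral_trichotomy (M : EuclideanSpace ℝ (Fin 3) →L[ℝ] EuclideanSpace ℝ (Fin 3)) (hdet0 : 0 < M.det) {R : ℝ} (hR1 : 1 < R)
    (hdR : M.det < R) :
    (∃ (Es Ec : Submodule ℝ (EuclideanSpace ℝ (Fin 3))) (k : ℕ) (a b : ℝ), IsCompl Es Ec ∧ (∀ x ∈ Es, M x ∈ Es) ∧
      (∀ x ∈ Ec, M x ∈ Ec) ∧ Ec ≠ ⊤ ∧ 0 < k ∧ a < 1 ∧ a < b ∧ (∀ x ∈ Es, ‖(M ^ k) x‖ ≤ a * ‖x‖) ∧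
      (∀ x ∈ Ec, b * ‖x‖ ≤ ‖(M ^ k) x‖)) ∨
    (∃ (Es Ec : Submodule ℝ (EuclideanSpace ℝ (Fin 3))) (k : ℕ) (a b : ℝ), IsCompl Es Ec ∧ (∀ x ∈ Es, (M * M) x ∈ Es) ∧
      (∀ x ∈ Ec, (M * M) x ∈ Ec) ∧ Ec ≠ ⊤ ∧ 0 < k ∧ a < 1 ∧ a < b ∧ (∀ x ∈ Es, ‖((M * M) ^ k) x‖ ≤ a * ‖x‖) ∧
      (∀ x ∈ Ec, b * ‖x‖ ≤ ‖((M * M) ^ k) x‖)) ∨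
    (∃ k₀ : ℕ, 0 < k₀ ∧ ‖M ^ k₀‖ < R ^ k₀) := by
  have hR0 : 0 < R := by linarith
  obtain ⟨μ, hμ0, v, hv, hMv⟩ := exists_pos_eigenvalue_of_det_pos M hdet0
  -- Case 1: the positive eigenvalue is large
  by_cases hμR : R ≤ μ
  · left
    exact exists_dominatedSplitting_pow M hv hMv (by linarith) hdet0 (by linarith)
  push Not at hμR
  -- cofactor of `μ`
  obtain ⟨u, w, hop, hroots, hwdet⟩ := exists_quadraticCofactor_det M hv hMv
  have hzero : ∀ x, M (M (M x) + u • M x + w • x) - μ • (M (M x) + u • M x + w • x) = 0 :=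
    fun x => sub_eq_zero.2 (hop x)
  have hweq : w = M.det / μ := by field_simp; linarith
  have hw0 : 0 < w := by rw [hweq]; exact div_pos hdet0 hμ0
  rcases lt_or_ge (u ^ 2) (4 * w) with hC | hReal
  · -- complex cofactor pair of modulus `√w`
    by_cases hwR : R ^ 2 ≤ w
    · -- expanding pair ⇒ `μ = det/w < 1`: contracting line under an expanding pair (T1)
      left
      have hμ1 : |μ| < 1 := by
        have hμw : μ = M.det / w := by field_simp; linarith
        rw [abs_of_pos hμ0, hμw, div_lt_one hw0]
        nlinarith
      exact exists_splitting_of_expandingPair M hv hMv hμ1 hC (by nlinarith) hzero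
    · -- all moduli `< R` ⇒ (T3)
      right; right
      push Not at hwR
      have hsw : Real.sqrt w < R := by
        rw [Real.sqrt_lt' hR0]; exact hwR
      set s : ℝ := max (Real.sqrt w) μ with hs
      have hs0 : 0 ≤ s := le_max_of_le_left (Real.sqrt_nonneg _)
      have hsR : s < R := max_lt hsw hμR
      obtain ⟨C, hC0, hCb⟩ := norm_pow_le_of_complexPair_global M (lam := μ) hC (le_max_left _ _)
        (by rw [abs_of_pos hμ0]; exact le_max_right _ _) hzero
      refine exists_normPow_lt_of_bound M hC0 hs0 hsR fun k x => (hCb k x).trans ?_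
      have : C * s ^ k * ‖x‖ ≤ C * ((k : ℝ) + 1) ^ 2 * s ^ k * ‖x‖ := by
        have h1 : (1 : ℝ) ≤ ((k : ℝ) + 1) ^ 2 := by nlinarith [(Nat.cast_nonneg k : (0:ℝ) ≤ k)]
        have h2 : 0 ≤ C * s ^ k * ‖x‖ := by positivity
        nlinarith
      exact this
  · -- real cofactor roots `r₁ = (−u + sq)/2`, `r₂ = (−u − sq)/2`
    set sr : ℝ := Real.sqrt (u ^ 2 - 4 * w) with hsr
    have hsr0 : 0 ≤ sr := Real.sqrt_nonneg _
    have hsr2 : sr * sr = u ^ 2 - 4 * w := Real.mul_self_sqrt (by linarith)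
    set r₁ : ℝ := (-u + sr) / 2 with hr₁
    set r₂ : ℝ := (-u - sr) / 2 with hr₂
    have hsum : r₁ + r₂ = -u := by rw [hr₁, hr₂]; ring
    have hprod : r₁ * r₂ = w := by rw [hr₁, hr₂]; nlinarith
    have hroot₁ : r₁ ^ 2 + u * r₁ + w = 0 := by nlinarith
    have hroot₂ : r₂ ^ 2 + u * r₂ + w = 0 := by nlinarith
    -- a real root of modulus `≥ R` gives (T1) or (T2)
    have hbig : ∀ r : ℝ, r ^ 2 + u * r + w = 0 → R ≤ |r| →
        (∃ (Es Ec : Submodule ℝ (EuclideanSpace ℝ (Fin 3))) (k : ℕ) (a b : ℝ), IsCompl Es Ec ∧ (∀ x ∈ Es, M x ∈ Es) ∧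
          (∀ x ∈ Ec, M x ∈ Ec) ∧ Ec ≠ ⊤ ∧ 0 < k ∧ a < 1 ∧ a < b ∧ (∀ x ∈ Es, ‖(M ^ k) x‖ ≤ a * ‖x‖) ∧
          (∀ x ∈ Ec, b * ‖x‖ ≤ ‖(M ^ k) x‖)) ∨
        (∃ (Es Ec : Submodule ℝ (EuclideanSpace ℝ (Fin 3))) (k : ℕ) (a b : ℝ), IsCompl Es Ec ∧ (∀ x ∈ Es, (M * M) x ∈ Es) ∧
          (∀ x ∈ Ec, (M * M) x ∈ Ec) ∧ Ec ≠ ⊤ ∧ 0 < k ∧ a < 1 ∧ a < b ∧ (∀ x ∈ Es, ‖((M * M) ^ k) x‖ ≤ a * ‖x‖) ∧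
          (∀ x ∈ Ec, b * ‖x‖ ≤ ‖((M * M) ^ k) x‖)) := by
      intro r hr hRr
      obtain ⟨vr, hvr, hMvr⟩ := hroots r hr
      rcases le_or_gt 0 r with hrpos | hrneg
      · -- `r ≥ R`: A′ for `M`
        left
        rw [abs_of_nonneg hrpos] at hRr
        exact exists_dominatedSplitting_pow M hvr hMvr (by linarith) hdet0 (by linarith)
      · -- `r ≤ −R`: A′ for `M·M` (eigenvalue `r² ≥ R² > det²`)
        right
        rw [abs_of_neg hrneg] at hRr
        have hMM : (M * M) vr = (r ^ 2) • vr := by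
          rw [ContinuousLinearMap.mul_def, ContinuousLinearMap.comp_apply, hMvr, map_smul, hMvr, smul_smul, pow_two]
        have hdet2 : (M * M).det = M.det * M.det := by
          rw [ContinuousLinearMap.det, ContinuousLinearMap.det,
            show ((M * M : EuclideanSpace ℝ (Fin 3) →L[ℝ] EuclideanSpace ℝ (Fin 3)) :
                EuclideanSpace ℝ (Fin 3) →ₗ[ℝ] EuclideanSpace ℝ (Fin 3)) =
              (M : EuclideanSpace ℝ (Fin 3) →ₗ[ℝ] EuclideanSpace ℝ (Fin 3)) * (M : EuclideanSpace ℝ (Fin 3) →ₗ[ℝ] EuclideanSpace ℝ (Fin 3))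
              from rfl, map_mul]
        have hr2 : R ^ 2 ≤ r ^ 2 := by nlinarith
        have hR2 : 1 < R ^ 2 := by nlinarith
        refine exists_dominatedSplitting_pow (M * M) hvr hMM (by linarith) (by rw [hdet2]; positivity) ?_
        rw [hdet2]
        nlinarith
    by_cases h₁ : R ≤ |r₁|
    · rcases hbig r₁ hroot₁ h₁ with h | h
      · exact Or.inl h
      · exact Or.inr (Or.inl h)
    by_cases h₂ : R ≤ |r₂|
    · rcases hbig r₂ hroot₂ h₂ with h | h
      · exact Or.inl h
      · exact Or.inr (Or.inl h)
    -- all three real roots of modulus `< R` ⇒ (T3)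
    right; right
    push Not at h₁ h₂
    set s : ℝ := max (max |r₁| |r₂|) μ with hs
    have hsμ : μ ≤ s := le_max_right _ _
    have hs0 : 0 < s := lt_of_lt_of_le hμ0 hsμ
    have hsR : s < R := max_lt (max_lt h₁ h₂) hμR
    have hχ : ∀ x : EuclideanSpace ℝ (Fin 3),
        M (M (M x - r₁ • x) - r₂ • (M x - r₁ • x)) = μ • (M (M x - r₁ • x) - r₂ • (M x - r₁ • x)) := by
      intro x
      have h := hop x
      have hu : u = -(r₁ + r₂) := by linarith
      rw [hu, ← hprod] at h
      have e : M (M x - r₁ • x) - r₂ • (M x - r₁ • x) = M (M x) + (-(r₁ + r₂)) • M x + (r₁ * r₂) • x := by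
        simp only [map_sub, map_smul]; module
      rw [e]; exact h
    have hgrow := norm_pow_le_of_realRoots_global M hs0.le ((le_max_left _ _).trans (le_max_left _ _))
      ((le_max_right _ _).trans (le_max_left _ _)) (by rw [abs_of_pos hμ0]; exact hsμ) hχ
    refine exists_normPow_lt_of_bound M (C := (‖M‖ + s) ^ 2 / s ^ 2) (by positivity) hs0.le hsR fun k x => ?_
    have h := hgrow k x
    have hs2 : 0 < s ^ 2 := by positivity
    rw [div_mul_eq_mul_div, div_mul_eq_mul_div, div_mul_eq_mul_div, le_div_iff₀ hs2]
    calc ‖(M ^ k) x‖ * s ^ 2 = s ^ 2 * ‖(M ^ k) x‖ := by ring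
      _ ≤ ((k : ℝ) + 1) ^ 2 * s ^ k * (‖M‖ + s) ^ 2 * ‖x‖ := h
      _ = (‖M‖ + s) ^ 2 * ((k : ℝ) + 1) ^ 2 * s ^ k * ‖x‖ := by ring

end Summit.NavierStokesRegularity.NavierStokesRegularity.Theorems.PowerGaugeEulerLiouville.DSSNodes

end
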